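import Summits.ResolutionOfSingularities.ResolutionOfSingularities.Theorems.PurelyInseparableDim4ChartAtlasSNCRepairStep
import HarnessLib

/-!
# Purely inseparable four-folds `z^p + F(x₁, …, x₄)`: the chart dictionary for a SHEARED boundary member under a later
# coordinate-centre blow-up (brick S3-N2 support, depth ≥ 3; cell `res-dim4-pi`, typ-2 g5)

[OURS · counted 0] (D-0157 DOOR 2; DR-157-C; row «TY-2 chart dictionary for coordinate centres»). After an N-class step of the
S3-N2 dichotomy the boundary of the walk carries SHEARED members `(x_m + b·x_j)·𝒪` (p690374, p696282). This file records, for ANY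
blowing up `π : W → 𝔸⁵` along a LATER coordinate centre `V(z, x_S)` and every chart `x_t` (`t ∈ S`), the reading of the strict
transform of such a member — i.e. whether the shape alphabet {coordinate, translated, sheared hyperplane} of the typ-2/typ-3 chart
model is CLOSED under the chart laws. PROVED here (no `sorry`, no new axiom):

* generic engine `strictTransformIdeal_specMap_subst_principal` / `strictTransformIdeal_principal_comap_chartImm`: if the chart
  substitution sends `f` to `x_t^k · g` with `x_t ∤ g` then `St_π(f·𝒪)` reads `g·𝒪` on the chart `x_t`; `not_coord_dvd_γ_symm_of_coeff`
  (a monomial free of `x_t` with non-zero coefficient witnesses `x_t ∤ g`);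
* `m, j ∈ S`: chart `x_m` → `(1 + b·x_j)·𝒪` (`strictTransformIdeal_shear_comap_chartImm_self`; `= (x_j + b⁻¹)·𝒪` for `b ≠ 0`,
  `…_self_of_ne_zero`), chart `x_t`, `t ∉ {m, j}` → `(x_m + b·x_j)·𝒪` again (`…_of_ne_of_ne`); chart `x_j` → `(x_m + b)·𝒪` is p693365's
  `strictTransformIdeal_shear_comap_chartImm`;
* `m ∈ S`, `j ∉ S`, `b ≠ 0`: chart `x_m` → itself (`…_mem_not_mem_self`); chart `x_t`, `t ≠ m` → **`(x_m·x_t + b·x_j)·𝒪` — NOT in the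
  alphabet** (`…_mem_not_mem_curved`);
* `m ∉ S`, `j ∈ S`: chart `x_j` → itself (`…_not_mem_mem_self`); chart `x_t`, `t ≠ j` → **`(x_m + b·x_j·x_t)·𝒪` — NOT in the alphabet**
  (`…_not_mem_mem_curved`);
* `m, j ∉ S`: every chart → itself (`…_not_mem_not_mem`).

So the alphabet is closed EXACTLY when `{m, j} ⊆ S` or `{m, j} ∩ S = ∅`; the two mixed cases produce quadric members (smooth, but no
longer hyperplanes in the chart coordinates) — a kernel-level form of the cost rider r5 on the N-class repair (crit-3 K-A3-26b/31).
Nothing here is a statement about resolution of singularities in dimension ≥ 4 / characteristic `p` (NOT proved anywhere in this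
programme). bears_on: LADDER-RESOLUTION:D157-DOOR2 (res-dim4-pi). Supports stmt-ResolutionOfSingularities-16155 (helper).
-/

-- every declaration of this summit lives under `Summit.ResolutionOfSingularities.ResolutionOfSingularities`
-- (summit = problem), which the duplicate-namespace linter flags; house convention (cf. the Target file).
set_option linter.dupNamespace false

noncomputable section

open MvPolynomial Finset CategoryTheory AlgebraicGeometry Opposite TopologicalSpace
open AlgebraicGeometry.Scheme.IdealSheafData (ofIdealTop vanishingIdeal)

namespace Summit.ResolutionOfSingularities.ResolutionOfSingularities.Theorems.PIDim4

open Literature.AlgebraicGeometry.Resolution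
open Literature.AlgebraicGeometry.Resolution.AffinePointBlowup (P A γ coord Wtop ξ)

namespace ChartDictionary

variable {K : Type} [Field K] {S : Finset (Fin 4)} {m j t : Fin 4} {W : Scheme.{0}} {π : W ⟶ P 4 K}

/-! ## §1 Generic engine: strict transform of a principal hypersurface on a coordinate chart -/

/-- A monomial `d` free of `x_t` with non-zero coefficient in `g` witnesses `x_t ∤ g` (in global sections of `𝔸⁵`). -/
theorem not_coord_dvd_γ_symm_of_coeff {t : Fin (4 + 1)} {g : A 4 K} (d : Fin (4 + 1) →₀ ℕ) (hd : d t = 0)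
    (hc : coeff d g ≠ 0) : ¬ coord 4 K t ∣ (γ 4 K).symm g := by
  classical
  rintro ⟨q, hq⟩
  have h := congrArg (γ 4 K) hq
  rw [RingEquiv.apply_symm_apply, map_mul, AffinePointBlowup.γ_coord] at h
  apply hc
  rw [h, coeff_X_mul', if_neg (by rw [Finsupp.mem_support_iff, not_not]; exact hd)]

/-- **Generic strict transform along the chart substitution.** If `ψ_t f = x_t^k · g` with `x_t ∤ g` then the saturation
`⋃ₙ (ψ_t^*(f·𝒪) : (x_t)ⁿ)` is `g·𝒪`. -/
theorem strictTransformIdeal_specMap_subst_principal (ht : t ∈ S) {f g : A 4 K} (k : ℕ)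
    (hψ : coordBlowupSubst K (insert 0 (Fin.succ '' (S : Set (Fin 4)))) t.succ f = X t.succ ^ k * g)
    (hg : ¬ coord 4 K t.succ ∣ (γ 4 K).symm g) :
    strictTransformIdeal
        (Spec.map (CommRingCat.ofHom
          (coordBlowupSubst K (insert 0 (Fin.succ '' (S : Set (Fin 4)))) t.succ).toRingHom))
        (AffineCoordBlowup.𝓘Λ 4 K (insert 0 (Fin.succ '' (S : Set (Fin 4)))))
        (ofIdealTop (Ideal.span {(γ 4 K).symm f})) =
      ofIdealTop (Ideal.span {(γ 4 K).symm g}) := by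
  rw [strictTransformIdeal, comap_𝓘Λ_specMap_subst (succ_mem_centreVars ht), comap_ofIdealTop_span_γ_symm]
  change ⨆ n : ℕ, colon (ofIdealTop (Ideal.span {(γ 4 K).symm (coordBlowupSubst K _ t.succ f)}))
      (ofIdealTop (Ideal.span {coord 4 K t.succ}) ^ n) = _
  rw [hψ, map_mul, map_pow, show (γ 4 K).symm (X t.succ) = coord 4 K t.succ from rfl]
  simp_rw [← ofIdealTop_pow, colon_ofIdealTop]
  rw [← ofIdealTop_iSup, iSup_colon_span_pow_mul_eq (prime_coord t.succ) hg]

/-- **Generic chart reading of a strict transform.** For ANY blowing up `π : W → 𝔸⁵` along `V(z, x_S)` and `t ∈ S`: if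
`ψ_t f = x_t^k · g` with `x_t ∤ g` then `St_π(f·𝒪)` reads `g·𝒪` on the chart `x_t`. -/
theorem strictTransformIdeal_principal_comap_chartImm (ht : t ∈ S) {f g : A 4 K} (k : ℕ)
    (hψ : coordBlowupSubst K (insert 0 (Fin.succ '' (S : Set (Fin 4)))) t.succ f = X t.succ ^ k * g)
    (hg : ¬ coord 4 K t.succ ∣ (γ 4 K).symm g)
    (hπ : IsBlowup π (AffineCoordBlowup.𝓘Λ 4 K (insert 0 (Fin.succ '' (S : Set (Fin 4)))))) :
    (strictTransformIdeal π (AffineCoordBlowup.𝓘Λ 4 K (insert 0 (Fin.succ '' (S : Set (Fin 4)))))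
        (ofIdealTop (Ideal.span {(γ 4 K).symm f}))).comap (AffineCoordBlowup.chartImm hπ (succ_mem_centreVars ht)) =
      ofIdealTop (Ideal.span {(γ 4 K).symm g}) := by
  haveI : IsProper π := hπ.isProper
  haveI : IsLocallyNoetherian W := LocallyOfFiniteType.isLocallyNoetherian π
  have hsq : AffineCoordBlowup.chartImm hπ (succ_mem_centreVars ht) ≫ π =
      Spec.map (CommRingCat.ofHom
        (coordBlowupSubst K (insert 0 (Fin.succ '' (S : Set (Fin 4)))) t.succ).toRingHom) ≫ 𝟙 (P 4 K) := by
    rw [Category.comp_id]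
    exact AffineCoordBlowup.chartImm_comp hπ (succ_mem_centreVars ht)
  rw [comap_strictTransformIdeal_of_flat (t := 𝟙 (P 4 K)) hsq, Scheme.IdealSheafData.comap_id,
    Scheme.IdealSheafData.comap_id, strictTransformIdeal_specMap_subst_principal ht k hψ hg]

/-- `x_t ∤ x_m + b·x_j` for `t ≠ m ≠ j` (the monomial `x_m` survives with coefficient `1`). -/
theorem not_coord_dvd_shear (htm : t ≠ m) (hmj : m ≠ j) (b : K) :
    ¬ coord 4 K t.succ ∣ (γ 4 K).symm (X m.succ + C b * X j.succ) := by
  classical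
  refine not_coord_dvd_γ_symm_of_coeff (Finsupp.single m.succ 1)
    (Finsupp.single_eq_of_ne (fun h => htm (Fin.succ_inj.mp h))) ?_
  rw [coeff_add, coeff_X, if_pos rfl, coeff_C_mul, coeff_X,
    if_neg (fun h => hmj (Fin.succ_inj.mp (Finsupp.single_left_injective one_ne_zero h)).symm), mul_zero, add_zero]
  exact one_ne_zero

/-! ## §2 Both indices in the centre: `m, j ∈ S` (the alphabet is closed) -/

/-- **`m, j ∈ S`, chart `x_m`: `St((x_m + b·x_j)·𝒪)` reads `(1 + b·x_j)·𝒪`** (`ψ_m` sends the member to `x_m (1 + b x_j)`). For `b = 0`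
this is `⊤` (the member `x_m·𝒪` is empty on its own chart); for `b ≠ 0` see `…_self_of_ne_zero`. -/
theorem strictTransformIdeal_shear_comap_chartImm_self (hm : m ∈ S) (hj : j ∈ S) (hmj : m ≠ j) (b : K)
    (hπ : IsBlowup π (AffineCoordBlowup.𝓘Λ 4 K (insert 0 (Fin.succ '' (S : Set (Fin 4)))))) :
    (strictTransformIdeal π (AffineCoordBlowup.𝓘Λ 4 K (insert 0 (Fin.succ '' (S : Set (Fin 4)))))
        (ofIdealTop (Ideal.span {(γ 4 K).symm (X m.succ + C b * X j.succ)}))).comap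
        (AffineCoordBlowup.chartImm hπ (succ_mem_centreVars hm)) =
      ofIdealTop (Ideal.span {(γ 4 K).symm (1 + C b * X j.succ)}) := by
  classical
  refine strictTransformIdeal_principal_comap_chartImm hm 1 ?_ ?_ hπ
  · rw [map_add, map_mul, coordBlowupSubst_C, coordBlowupSubst_X_self,
      coordBlowupSubst_X_of_mem_of_ne K _ m.succ (succ_mem_centreVars hj) (fun e => hmj (Fin.succ_inj.mp e).symm)]
    ring
  · refine not_coord_dvd_γ_symm_of_coeff 0 rfl ?_
    rw [coeff_add, coeff_one, if_pos rfl, coeff_C_mul, coeff_zero_X, mul_zero, add_zero]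
    exact one_ne_zero

/-- **`m, j ∈ S`, `b ≠ 0`, chart `x_m`: `St((x_m + b·x_j)·𝒪)` reads the TRANSLATED hyperplane `(x_j + b⁻¹)·𝒪`** (back in the alphabet:
it misses `x_j·𝒪` and meets the new exceptional component `x_m·𝒪` transversally). -/
theorem strictTransformIdeal_shear_comap_chartImm_self_of_ne_zero (hm : m ∈ S) (hj : j ∈ S) (hmj : m ≠ j) {b : K} (hb : b ≠ 0)
    (hπ : IsBlowup π (AffineCoordBlowup.𝓘Λ 4 K (insert 0 (Fin.succ '' (S : Set (Fin 4)))))) :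
    (strictTransformIdeal π (AffineCoordBlowup.𝓘Λ 4 K (insert 0 (Fin.succ '' (S : Set (Fin 4)))))
        (ofIdealTop (Ideal.span {(γ 4 K).symm (X m.succ + C b * X j.succ)}))).comap
        (AffineCoordBlowup.chartImm hπ (succ_mem_centreVars hm)) =
      ofIdealTop (Ideal.span {(γ 4 K).symm (X j.succ + C b⁻¹)}) := by
  rw [strictTransformIdeal_shear_comap_chartImm_self hm hj hmj b hπ]
  have h1 : (1 + C b * X j.succ : A 4 K) = C b * (X j.succ + C b⁻¹) := by
    rw [mul_add, ← C_mul, mul_inv_cancel₀ hb, C_1, add_comm]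
  have hu : IsUnit ((γ 4 K).symm (C b : A 4 K)) := ((isUnit_iff_ne_zero.mpr hb).map C).map _
  rw [h1, map_mul, Ideal.span_singleton_mul_left_unit hu]

/-- **`m, j ∈ S`, chart `x_t` with `t ∈ S ∖ {m, j}`: `St((x_m + b·x_j)·𝒪)` reads `(x_m + b·x_j)·𝒪` again** — a sheared member stays
sheared (`ψ_t` multiplies both `x_m` and `x_j` by `x_t`). -/
theorem strictTransformIdeal_shear_comap_chartImm_of_ne_of_ne (ht : t ∈ S) (hm : m ∈ S) (hj : j ∈ S) (htm : t ≠ m)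
    (htj : t ≠ j) (hmj : m ≠ j) (b : K)
    (hπ : IsBlowup π (AffineCoordBlowup.𝓘Λ 4 K (insert 0 (Fin.succ '' (S : Set (Fin 4)))))) :
    (strictTransformIdeal π (AffineCoordBlowup.𝓘Λ 4 K (insert 0 (Fin.succ '' (S : Set (Fin 4)))))
        (ofIdealTop (Ideal.span {(γ 4 K).symm (X m.succ + C b * X j.succ)}))).comap
        (AffineCoordBlowup.chartImm hπ (succ_mem_centreVars ht)) =
      ofIdealTop (Ideal.span {(γ 4 K).symm (X m.succ + C b * X j.succ)}) := by
  refine strictTransformIdeal_principal_comap_chartImm ht 1 ?_ (not_coord_dvd_shear htm hmj b) hπ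
  rw [map_add, map_mul, coordBlowupSubst_C,
    coordBlowupSubst_X_of_mem_of_ne K _ t.succ (succ_mem_centreVars hm) (fun e => htm (Fin.succ_inj.mp e).symm),
    coordBlowupSubst_X_of_mem_of_ne K _ t.succ (succ_mem_centreVars hj) (fun e => htj (Fin.succ_inj.mp e).symm)]
  ring

/-! ## §3 Mixed case `m ∈ S`, `j ∉ S` (`b ≠ 0`): the alphabet is NOT closed off the chart `x_m` -/

/-- **`m ∈ S`, `j ∉ S`, `b ≠ 0`, chart `x_m`: `St((x_m + b·x_j)·𝒪)` reads `(x_m + b·x_j)·𝒪`** (the member is not divisible by `x_m`: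
strict = total transform). -/
theorem strictTransformIdeal_shear_comap_chartImm_mem_not_mem_self (hm : m ∈ S) (hj : j ∉ S) {b : K} (hb : b ≠ 0)
    (hπ : IsBlowup π (AffineCoordBlowup.𝓘Λ 4 K (insert 0 (Fin.succ '' (S : Set (Fin 4)))))) :
    (strictTransformIdeal π (AffineCoordBlowup.𝓘Λ 4 K (insert 0 (Fin.succ '' (S : Set (Fin 4)))))
        (ofIdealTop (Ideal.span {(γ 4 K).symm (X m.succ + C b * X j.succ)}))).comap
        (AffineCoordBlowup.chartImm hπ (succ_mem_centreVars hm)) =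
      ofIdealTop (Ideal.span {(γ 4 K).symm (X m.succ + C b * X j.succ)}) := by
  classical
  have hjm : j ≠ m := fun h => hj (h ▸ hm)
  refine strictTransformIdeal_principal_comap_chartImm hm 0 ?_ ?_ hπ
  · rw [map_add, map_mul, coordBlowupSubst_C, coordBlowupSubst_X_self,
      coordBlowupSubst_X_of_not_mem K _ m.succ (fun h => hj ((succ_mem_centreVars_iff S j).mp h)), pow_zero, one_mul]
  · refine not_coord_dvd_γ_symm_of_coeff (Finsupp.single j.succ 1)
      (Finsupp.single_eq_of_ne (fun h => hjm (Fin.succ_inj.mp h).symm)) ?_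
    rw [coeff_add, coeff_X, if_neg (fun h => hjm (Fin.succ_inj.mp (Finsupp.single_left_injective one_ne_zero h)).symm),
      coeff_C_mul, coeff_X, if_pos rfl, mul_one, zero_add]
    exact hb

/-- **`m ∈ S`, `j ∉ S`, `b ≠ 0`, chart `x_t` with `t ∈ S ∖ {m}`: `St((x_m + b·x_j)·𝒪)` reads the QUADRIC `(x_m·x_t + b·x_j)·𝒪`** — smooth
(`∂/∂x_j = b ≠ 0`) but NOT a coordinate / translated / sheared hyperplane of the chart: the shape alphabet of the chart model is not
closed here. -/
theorem strictTransformIdeal_shear_comap_chartImm_mem_not_mem_curved (ht : t ∈ S) (hm : m ∈ S) (htm : t ≠ m) (hj : j ∉ S)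
    {b : K} (hb : b ≠ 0) (hπ : IsBlowup π (AffineCoordBlowup.𝓘Λ 4 K (insert 0 (Fin.succ '' (S : Set (Fin 4)))))) :
    (strictTransformIdeal π (AffineCoordBlowup.𝓘Λ 4 K (insert 0 (Fin.succ '' (S : Set (Fin 4)))))
        (ofIdealTop (Ideal.span {(γ 4 K).symm (X m.succ + C b * X j.succ)}))).comap
        (AffineCoordBlowup.chartImm hπ (succ_mem_centreVars ht)) =
      ofIdealTop (Ideal.span {(γ 4 K).symm (X m.succ * X t.succ + C b * X j.succ)}) := by
  classical
  have hjt : j ≠ t := fun h => hj (h ▸ ht)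
  have hjm : j ≠ m := fun h => hj (h ▸ hm)
  refine strictTransformIdeal_principal_comap_chartImm ht 0 ?_ ?_ hπ
  · rw [map_add, map_mul, coordBlowupSubst_C,
      coordBlowupSubst_X_of_mem_of_ne K _ t.succ (succ_mem_centreVars hm) (fun e => htm (Fin.succ_inj.mp e).symm),
      coordBlowupSubst_X_of_not_mem K _ t.succ (fun h => hj ((succ_mem_centreVars_iff S j).mp h)), pow_zero, one_mul, mul_comm]
  · refine not_coord_dvd_γ_symm_of_coeff (Finsupp.single j.succ 1)
      (Finsupp.single_eq_of_ne (fun h => hjt (Fin.succ_inj.mp h).symm)) ?_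
    rw [coeff_add, coeff_X_mul', if_neg (fun h => hjm (Fin.succ_inj.mp (Finsupp.mem_support_single _ _ _ |>.mp h).1).symm),
      coeff_C_mul, coeff_X, if_pos rfl, mul_one, zero_add]
    exact hb

/-! ## §4 Mixed case `m ∉ S`, `j ∈ S`: the alphabet is NOT closed off the chart `x_j` -/

/-- **`m ∉ S`, `j ∈ S`, chart `x_j`: `St((x_m + b·x_j)·𝒪)` reads `(x_m + b·x_j)·𝒪`** (`ψ_j` fixes both variables). -/
theorem strictTransformIdeal_shear_comap_chartImm_not_mem_mem_self (hm : m ∉ S) (hj : j ∈ S) (b : K)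
    (hπ : IsBlowup π (AffineCoordBlowup.𝓘Λ 4 K (insert 0 (Fin.succ '' (S : Set (Fin 4)))))) :
    (strictTransformIdeal π (AffineCoordBlowup.𝓘Λ 4 K (insert 0 (Fin.succ '' (S : Set (Fin 4)))))
        (ofIdealTop (Ideal.span {(γ 4 K).symm (X m.succ + C b * X j.succ)}))).comap
        (AffineCoordBlowup.chartImm hπ (succ_mem_centreVars hj)) =
      ofIdealTop (Ideal.span {(γ 4 K).symm (X m.succ + C b * X j.succ)}) := by
  have hjm : j ≠ m := fun h => hm (h ▸ hj)
  refine strictTransformIdeal_principal_comap_chartImm hj 0 ?_ (not_coord_dvd_shear hjm hjm.symm b) hπ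
  rw [map_add, map_mul, coordBlowupSubst_C, coordBlowupSubst_X_self,
    coordBlowupSubst_X_of_not_mem K _ j.succ (fun h => hm ((succ_mem_centreVars_iff S m).mp h)), pow_zero, one_mul]

/-- **`m ∉ S`, `j ∈ S`, chart `x_t` with `t ∈ S ∖ {j}`: `St((x_m + b·x_j)·𝒪)` reads `(x_m + b·x_j·x_t)·𝒪`** — for `b ≠ 0` again a smooth
quadric outside the shape alphabet. -/
theorem strictTransformIdeal_shear_comap_chartImm_not_mem_mem_curved (ht : t ∈ S) (htj : t ≠ j) (hm : m ∉ S) (hj : j ∈ S)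
    (b : K) (hπ : IsBlowup π (AffineCoordBlowup.𝓘Λ 4 K (insert 0 (Fin.succ '' (S : Set (Fin 4)))))) :
    (strictTransformIdeal π (AffineCoordBlowup.𝓘Λ 4 K (insert 0 (Fin.succ '' (S : Set (Fin 4)))))
        (ofIdealTop (Ideal.span {(γ 4 K).symm (X m.succ + C b * X j.succ)}))).comap
        (AffineCoordBlowup.chartImm hπ (succ_mem_centreVars ht)) =
      ofIdealTop (Ideal.span {(γ 4 K).symm (X m.succ + C b * (X j.succ * X t.succ))}) := by
  classical
  have htm : t ≠ m := fun h => hm (h ▸ ht)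
  have hjm : j ≠ m := fun h => hm (h ▸ hj)
  refine strictTransformIdeal_principal_comap_chartImm ht 0 ?_ ?_ hπ
  · rw [map_add, map_mul, coordBlowupSubst_C,
      coordBlowupSubst_X_of_not_mem K _ t.succ (fun h => hm ((succ_mem_centreVars_iff S m).mp h)),
      coordBlowupSubst_X_of_mem_of_ne K _ t.succ (succ_mem_centreVars hj) (fun e => htj (Fin.succ_inj.mp e).symm),
      pow_zero, one_mul, mul_comm (X t.succ)]
  · refine not_coord_dvd_γ_symm_of_coeff (Finsupp.single m.succ 1)
      (Finsupp.single_eq_of_ne (fun h => htm (Fin.succ_inj.mp h))) ?_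
    rw [coeff_add, coeff_X, if_pos rfl, coeff_C_mul, coeff_X_mul',
      if_neg (fun h => hjm (Fin.succ_inj.mp (Finsupp.mem_support_single _ _ _ |>.mp h).1)), mul_zero, add_zero]
    exact one_ne_zero

/-! ## §5 Both indices off the centre: `m, j ∉ S` (the member is untouched) -/

/-- **`m, j ∉ S`, any chart `x_t`, `t ∈ S`: `St((x_m + b·x_j)·𝒪)` reads `(x_m + b·x_j)·𝒪`.** -/
theorem strictTransformIdeal_shear_comap_chartImm_not_mem_not_mem (ht : t ∈ S) (hm : m ∉ S) (hj : j ∉ S) (hmj : m ≠ j)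
    (b : K) (hπ : IsBlowup π (AffineCoordBlowup.𝓘Λ 4 K (insert 0 (Fin.succ '' (S : Set (Fin 4)))))) :
    (strictTransformIdeal π (AffineCoordBlowup.𝓘Λ 4 K (insert 0 (Fin.succ '' (S : Set (Fin 4)))))
        (ofIdealTop (Ideal.span {(γ 4 K).symm (X m.succ + C b * X j.succ)}))).comap
        (AffineCoordBlowup.chartImm hπ (succ_mem_centreVars ht)) =
      ofIdealTop (Ideal.span {(γ 4 K).symm (X m.succ + C b * X j.succ)}) := by
  have htm : t ≠ m := fun h => hm (h ▸ ht)
  refine strictTransformIdeal_principal_comap_chartImm ht 0 ?_ (not_coord_dvd_shear htm hmj b) hπ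
  rw [map_add, map_mul, coordBlowupSubst_C,
    coordBlowupSubst_X_of_not_mem K _ t.succ (fun h => hm ((succ_mem_centreVars_iff S m).mp h)),
    coordBlowupSubst_X_of_not_mem K _ t.succ (fun h => hj ((succ_mem_centreVars_iff S j).mp h)), pow_zero, one_mul]

end ChartDictionary

end Summit.ResolutionOfSingularities.ResolutionOfSingularities.Theorems.PIDim4

end
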